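/-
COR-CM (cell pub-hodgecm2, stage 2 of the Hodge ladder) — count-neutral KERNEL COMBINATORICS «the index-two cyclic census of INVERSION TYPE, every level:
μ = φ₂ for every finite group with a cyclic subgroup ⟨u⟩ ∋ c = uⁿ of index two inverted by some element outside it — dihedral D_{4n} and dicyclic Q_{4n}
at once, ONE theorem» (seat prover-pub-hodgecm2-b23-g50-0, binder prover b23, gen 50; own census lane INDEX-TWO CYCLIC 2-GROUPS, extension «SMALL DEGREES»,
claim HOME/INBOX.md l.23042, INTERIM #1 l.23124).  Theorems only; `Census/IndexTwoCyclicNormalForm.lean`, `Census/IndexTwoCyclicQuaternion.lean` (this seat),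
seat b23 gen 48ʼs `Census/DihedralLaw.lean` and seat b09ʼs quaternion column (through the transport) are used BY NAME.  No definition, no `decide`, no
certificate, no named fact, no `sorry`.  `Interfaces.lean` (C1), every E term, B01, `Transposition/*`, `PortJoin/*`, `D2Bridge/*` untouched.
HONEST FRAMING: `HC_CM` is NOT proved, here or anywhere in the tree; nothing here is a period, a count of record or a headline.
T5: n/a-class (hypothesis binders: `orderOf u = 2n`, `uⁿ = c`, `[G:⟨u⟩] = 2`, `w ∉ ⟨u⟩`, `w u w⁻¹ = u⁻¹`, `2 ≤ n`, `c·c = 1`, `c ≠ 1` — inhabited by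
`DihedralGroup 4` and `QuaternionGroup 2`; checker: self, 2026-08-25).
-/
import Summits.HodgeConjecture.CorCM.Census.IndexTwoCyclicQuaternion
import Summits.HodgeConjecture.CorCM.Census.IndexTwoCyclicNormalForm
import Summits.HodgeConjecture.CorCM.Census.DihedralLaw
import HarnessLib

/-!
# The index-two cyclic census of inversion type: dihedral and dicyclic groups of every order at once

Let `u ∈ G` have order `2n` (`n ≥ 2`) with `[G : ⟨u⟩] = 2` and `c = uⁿ`, and suppose SOME `w ∉ ⟨u⟩` inverts `u`: `w u w⁻¹ = u⁻¹`.  Then `w² ∈ ⟨u⟩` is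
fixed AND inverted by conjugation with `w`, so `w⁴ = 1`: `w² ∈ {1, c}` (§1 `mul_self_eq_one_or_eq_of_inverting`).  If `w² = 1` then EVERY element
outside `⟨u⟩` is an involution (`(w uⁱ)² = u^{j + (r+1) i}` with `r ≡ −1`) and `G` carries seat b23 gen 48ʼs DIHEDRAL datum (`μ = β − 2 = φ₂`,
`Census/DihedralLaw.lean`); if `w² = c` the quaternion presentation holds and seat b09ʼs column applies through `Census/IndexTwoCyclicQuaternion.lean`
(`μ = β − [n odd] = φ₂`).  Hence, at EVERY level `n ≥ 2` (no parity, no 2-power hypothesis):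

* §2 **`isLeast_card_gfaces_generate_fibreTwo_of_inverting (hc2) (hc1) (u w) (h2 : 2 ≤ n) (hun : uⁿ = c) (hord) (hindex) (hw) (hwu : w u w⁻¹ = u⁻¹)`**:
  `IsLeast {|S| : S ⊆ gfaceSet generating hodgeSpan mod pairs} (φ₂(G, c))` — the dihedral groups `D_{4n}` (conjugation the central rotation) and the
  dicyclic / generalised quaternion groups `Q_{4n}` of every order, classification-free and abstract (for `Q_{4n}` with `n` even this is the first abstract
  form: seat b09ʼs column lives on Mathlibʼs concrete `QuaternionGroup n`).  Field level: `CorCM/FaceIndexTwoCyclicInversion.lean`.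

## References
* [Pohlmann1968] H. Pohlmann, Algebraic cycles on abelian varieties of complex multiplication type, Ann. of Math. 88 (1968), Thm 1.
-/

namespace Summit.HodgeConjecture.CorCM.Census.IndexTwoCyclic

open Finset
open Summit.HodgeConjecture.CorCM.Prior.AllgGroup.RfwfAllgGroup
open Summit.HodgeConjecture.CorCM.Census.BlockParity
open Summit.HodgeConjecture.CorCM.Census.Coinvariant

/-! ## §1 An inverting coset element squares to `1` or to `c` -/

/-- Conjugation by an inverting element inverts every power: `w uⁱ w⁻¹ = (uⁱ)⁻¹`. [folklore] -/
theorem conj_pow_eq_inv_of_inverting {G : Type*} [Group G] {u w : G} (hwu : w * u * w⁻¹ = u⁻¹) (i : ℕ) : w * u ^ i * w⁻¹ = (u ^ i)⁻¹ := by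
  rw [← MulAut.conj_apply, map_pow, MulAut.conj_apply, hwu, inv_pow]

/-- An inverting element in exponent form: `w u w⁻¹ = u^{2n−1}` (`ord u = 2n`, `n ≠ 0`). [folklore] -/
theorem conj_eq_pow_of_inverting {G : Type*} [Group G] {u w : G} {n : ℕ} (hord : orderOf u = 2 * n) (hn : n ≠ 0) (hwu : w * u * w⁻¹ = u⁻¹) :
    w * u * w⁻¹ = u ^ (2 * n - 1) := by
  rw [hwu]
  apply inv_eq_of_mul_eq_one_right
  rw [← pow_succ', Nat.sub_add_cancel (by omega), ← hord, pow_orderOf_eq_one]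

/-- **An inverting coset element squares to `1` or to `uⁿ`**: `w² ∈ ⟨u⟩` is both fixed and inverted by `w`. [folklore] -/
theorem mul_self_eq_one_or_eq_pow_of_inverting {G : Type*} [Group G] [Finite G] {u w : G} {n : ℕ} (hord : orderOf u = 2 * n)
    (hindex : (Subgroup.zpowers u).index = 2) (hwu : w * u * w⁻¹ = u⁻¹) : w * w = 1 ∨ w * w = u ^ n := by
  by_cases h1 : w * w = 1
  · exact Or.inl h1
  right
  have hmem : w * w ∈ Subgroup.zpowers u := mul_self_mem_of_index_two hindex w
  obtain ⟨j, -, hj⟩ := exists_pow_eq_of_mem_zpowers hmem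
  -- `w (w w) w⁻¹ = w w` and `w uʲ w⁻¹ = (uʲ)⁻¹`, so `(w w)⁻¹ = w w`
  have hinv : (w * w)⁻¹ = w * w := by
    have h := conj_pow_eq_inv_of_inverting hwu j
    rw [hj] at h
    rw [← h]
    group
  have hsq : (w * w) * (w * w) = 1 := by
    nth_rewrite 1 [← hinv]
    exact inv_mul_cancel (w * w)
  exact eq_pow_of_mem_zpowers_of_mul_self hord hmem hsq h1

/-- **If an inverting coset element is an involution, every element outside `⟨u⟩` is an involution** (the dihedral side). [folklore] -/
theorem mul_self_eq_one_of_inverting {G : Type*} [Group G] [Finite G] {u w : G} {n : ℕ} (hord : orderOf u = 2 * n) (hn : n ≠ 0)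
    (hindex : (Subgroup.zpowers u).index = 2) (hw : w ∉ Subgroup.zpowers u) (hwu : w * u * w⁻¹ = u⁻¹) (hww : w * w = 1)
    (x : G) (hx : x ∉ Subgroup.zpowers u) : x * x = 1 := by
  have hwx : w⁻¹ * x ∈ Subgroup.zpowers u := by
    rw [Subgroup.mul_mem_iff_of_index_two hindex, Subgroup.inv_mem_iff]
    exact ⟨fun h => absurd h hw, fun h => absurd h hx⟩
  obtain ⟨i, -, hi⟩ := exists_pow_eq_of_mem_zpowers hwx
  have hxe : x = w * u ^ i := by rw [hi, mul_inv_cancel_left]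
  rw [hxe, coset_mul_self (conj_eq_pow_of_inverting hord hn hwu) (by rw [hww, pow_zero] : w * w = u ^ 0) i, zero_add,
    Nat.sub_add_cancel (by omega), pow_mul, ← hord, pow_orderOf_eq_one, one_pow]

/-! ## §2 The census of inversion type -/

/-- **THE INDEX-TWO CYCLIC CENSUS OF INVERSION TYPE, EVERY LEVEL `n ≥ 2`: `μ(G, c) = φ₂(G, c)`** — `u` of order `2n` with `uⁿ = c`, `[G : ⟨u⟩] = 2`,
and some `w ∉ ⟨u⟩` with `w u w⁻¹ = u⁻¹`: the dihedral groups `D_{4n}` (seat b23 gen 48) and the dicyclic groups `Q_{4n}` (seat b09, transported) of every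
order in ONE classification-free theorem. [folklore] -/
theorem isLeast_card_gfaces_generate_fibreTwo_of_inverting {G : Type*} [Group G] [Fintype G] [DecidableEq G] {c : G} (hc2 : c * c = 1)
    (hc1 : c ≠ 1) (u w : G) {n : ℕ} (h2 : 2 ≤ n) (hun : u ^ n = c) (hord : orderOf u = 2 * n) (hindex : (Subgroup.zpowers u).index = 2)
    (hw : w ∉ Subgroup.zpowers u) (hwu : w * u * w⁻¹ = u⁻¹) :
    IsLeast {m : ℕ | ∃ S : Finset (CMF G c →₀ ℤ), ↑S ⊆ gfaceSet G c hc2 ∧ S.card = m ∧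
      hodgeSpan c hc2 ≤ Submodule.span ℤ (pairSet c) ⊔ Submodule.span ℤ (translates c S)} (fibreTwo c hc2) := by
  haveI : NeZero n := ⟨by omega⟩
  rcases mul_self_eq_one_or_eq_pow_of_inverting hord hindex hwu with hww | hww
  · -- dihedral: every element outside `⟨u⟩` is an involution
    let D : Dihedral.Datum G c n := ⟨u, w, hun, hord, hindex, hw, mul_self_eq_one_of_inverting hord (by omega) hindex hw hwu hww⟩
    exact Dihedral.isLeast_card_gfaces_generate_fibreTwo D hc2 hc1
  · -- dicyclic / generalised quaternion
    exact isLeast_card_gfaces_generate_fibreTwo_of_quaternion hc2 u w hun hord hindex hw (hww.trans hun) hwu h2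

/-- **Block currency**: `μ = β − 2` on the dihedral side (`w² = 1`), `μ = β − [n odd]` on the dicyclic side (`w² = c`) — here the DIHEDRAL reading for an
inverting involution at every level `n ≥ 1`. [folklore] -/
theorem isLeast_card_gfaces_generate_of_inverting_involution {G : Type*} [Group G] [Fintype G] [DecidableEq G] {c : G} (hc2 : c * c = 1)
    (hc1 : c ≠ 1) (u w : G) {n : ℕ} (hn : n ≠ 0) (hun : u ^ n = c) (hord : orderOf u = 2 * n) (hindex : (Subgroup.zpowers u).index = 2)
    (hw : w ∉ Subgroup.zpowers u) (hwu : w * u * w⁻¹ = u⁻¹) (hww : w * w = 1) :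
    IsLeast {m : ℕ | ∃ S : Finset (CMF G c →₀ ℤ), ↑S ⊆ gfaceSet G c hc2 ∧ S.card = m ∧
      hodgeSpan c hc2 ≤ Submodule.span ℤ (pairSet c) ⊔ Submodule.span ℤ (translates c S)} (Fintype.card (Block c) - 2) := by
  haveI : NeZero n := ⟨hn⟩
  let D : Dihedral.Datum G c n := ⟨u, w, hun, hord, hindex, hw, mul_self_eq_one_of_inverting hord hn hindex hw hwu hww⟩
  exact Dihedral.isLeast_card_gfaces_generate D hc2 hc1

end Summit.HodgeConjecture.CorCM.Census.IndexTwoCyclic
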